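/-
Copyright (c) 2026 the pub-hodgecm-mathlib formalisation cell (harness21).  Prover seat hodgecm-mathlib-K2E5-p16 (g5): Track B «K2-LIT»,
hLiu418 = stmt-HodgeConjecture-24832, ROAD Φ organ Φ6b-5 (lattice Fourier series of `Ξ` over the places), file (6a): head (H1)
`differentiableOn_tsum_prod_xiShift` of the binding deal K2E5-plan (g6) 2026-09-04 08:40:55Z; 2026-09-04.
-/
import Summits.HodgeConjecture.HodgeConjecture.Theorems.K2LiuHermTwoXiShiftGrowth          -- (4b-iii): `norm_xiShift_le₂`
import Summits.HodgeConjecture.HodgeConjecture.Theorems.K2LiuHermTwoXiBetaShift            -- (5): `differentiableOn_xiShift_affine`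
import Summits.HodgeConjecture.HodgeConjecture.Theorems.K2LiuHermTwoXiSeries               -- ★ p858221: the one-place template
import HarnessLib

/-!
# Crux `HLiu418`, ROAD Φ, organ Φ6b-5 — file (6a): `s ↦ Σ_i c_i(s) · ∏_σ Ξ(g_σ, h_{i,σ}; α₀σ + us, β₀σ + vs)` is holomorphic on `U ⊆ {0 < re β}`

Cell `hodgecm-mathlib`, crux item hLiu418 = `stmt-HodgeConjecture-24832`, route of record `HCCMUnconditional`; squad K2, LEAD F0P6-plan (g13),
co-dealer K2E5-plan (g6) (binding deal Φ6b-5, head (H1), «= AS HEADED» 08:50:17Z), prover K2E5-p16 (g5).  THEOREMS ONLY; lane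
`--supports stmt-HodgeConjecture-24832 --as helper`.

THE SUMMATION STEP OVER THE PLACES (`differentiableOn_tsum_prod_xiShift`).  `S` a finite type (the real places), `g : S → Herm₂⁺`,
`h : ι → S → Herm₂⁺`, exponents `α₀ β₀ : S → ℂ`, a complex line `s ↦ (α₀σ + us, β₀σ + vs)`, an open `U` with `0 < re(β₀σ + vs)` on `U` for
every `σ` (ONE UNIT LEFT of ★ `differentiableOn_tsum_xiEta`'s `1 <`, thanks to the β-shift), coefficients `c_i` holomorphic on `U` with
`|c_i(s)| ≤ A ∏_σ (1 + tr h_{iσ})^M` locally uniformly, and the lattice summability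
  `∀ N N′ ≥ 0, Σ_i ∏_σ e^{−2π Re tr(h_{iσ} g_σ)} (1 + tr h_{iσ})^N (1 + det(h_{iσ})^{−N′}) < ∞`
(= ★ file (6b) `summable_lattice_prod_majorant` for the totally positive points of a discrete lattice).  Then
`s ↦ Σ_i c_i(s) ∏_σ xiShift(g_σ, h_{iσ}; α₀σ + us, β₀σ + vs)` is complex-differentiable on `U` — per place ★ `norm_xiShift_le₂` on the compact
images of a small closed ball and ★ `differentiableOn_xiShift_affine`, `Finset.prod_le_prod` ∕ `DifferentiableOn.fun_finsetProd`, and Mathlib's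
`differentiableOn_tsum_of_summable_norm`.
HONEST LABEL.  Count-neutral helper of the K2_Liu road; it pays no socket by itself: `HC_CM` is proved only modulo the 7 printed citations
(2 remaining named inputs: hLiu418 = `stmt-HodgeConjecture-24832`, h413 = `stmt-HodgeConjecture-24833`) until rung 0 closes.
-/

set_option autoImplicit false
-- the mandated namespace repeats the single-problem summit's segment (`HodgeConjecture.HodgeConjecture`)
set_option linter.dupNamespace false

noncomputable section

open Complex Set
open scoped ComplexOrder ComplexConjugate

namespace Summit.HodgeConjecture.HodgeConjecture.Cruxes.HLiu418.K2LiuHermTwoXiSeriesLattice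

open Summit.HodgeConjecture.HodgeConjecture.Cruxes.HLiu418.K2LiuHermTwoGammaDefs
open Summit.HodgeConjecture.HodgeConjecture.Cruxes.HLiu418.K2LiuHermTwoEtaShiftDefs
open Summit.HodgeConjecture.HodgeConjecture.Cruxes.HLiu418.K2LiuHermTwoXiBetaShift
open Summit.HodgeConjecture.HodgeConjecture.Cruxes.HLiu418.K2LiuHermTwoXiShiftGrowth
open Summit.HodgeConjecture.HodgeConjecture.Cruxes.HLiu418.K2LiuHermTwoXiSeries

/-- Merging det-exponents: for `x > 0`, `0 ≤ a ≤ b`: `1 + x^{−a} ≤ 2 · (1 + x^{−b})`. -/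
theorem one_add_rpow_neg_le_two_mul {x a b : ℝ} (hx : 0 < x) (ha : 0 ≤ a) (hab : a ≤ b) :
    1 + x ^ (-a) ≤ 2 * (1 + x ^ (-b)) := by
  have h := Literature.Dynamics.TransferOperators.rpow_neg_le_add (a := a) (a₁ := 0) (a₂ := b) hx ha hab
  rw [neg_zero, Real.rpow_zero] at h
  linarith [Real.rpow_nonneg hx.le (-b)]

/-- **HOLOMORPHY OF LATTICE SERIES OF `∏_σ Ξ_σ` ALONG COMPLEX LINES IN `ℂ × {re β > 0}`** (head (H1) of Φ6b-5): see the module docstring. -/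
theorem differentiableOn_tsum_prod_xiShift {ι S : Type*} [Fintype S] {g : S → Matrix (Fin 2) (Fin 2) ℂ} (hg : ∀ σ, (g σ).PosDef)
    (h : ι → S → Matrix (Fin 2) (Fin 2) ℂ) (hh : ∀ i σ, (h i σ).PosDef) (α₀ β₀ : S → ℂ) (u v : ℂ) {U : Set ℂ} (hU : IsOpen U)
    (hU0 : ∀ s ∈ U, ∀ σ, 0 < (β₀ σ + v * s).re) (c : ι → ℂ → ℂ) (hc : ∀ i, DifferentiableOn ℂ (c i) U)
    (hcb : ∀ K ⊆ U, IsCompact K → ∃ A M : ℝ, 0 ≤ A ∧ ∀ i, ∀ s ∈ K, ‖c i s‖ ≤ A * ∏ σ, (1 + ((h i σ 0 0).re + (h i σ 1 1).re)) ^ M)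
    (hsum : ∀ N N' : ℝ, 0 ≤ N → 0 ≤ N' → Summable fun i => ∏ σ, (Real.exp (-(2 * Real.pi * ((h i σ * g σ).trace).re)) *
      (1 + ((h i σ 0 0).re + (h i σ 1 1).re)) ^ N * (1 + ((h i σ 0 0).re * (h i σ 1 1).re - normSq (h i σ 0 1)) ^ (-N')))) :
    DifferentiableOn ℂ (fun s : ℂ => ∑' i, c i s * ∏ σ, xiShift (g σ) (h i σ) (α₀ σ + u * s) (β₀ σ + v * s)) U := by
  intro s₀ hs₀
  obtain ⟨r, hr, hball⟩ := Metric.isOpen_iff.mp hU s₀ hs₀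
  have hr2 : 0 < r / 2 := by linarith
  -- a compact ball inside `U` and its images on the exponent lines, place by place
  have hKU : Metric.closedBall s₀ (r / 2) ⊆ U := (Metric.closedBall_subset_ball (by linarith)).trans hball
  have hKc : IsCompact (Metric.closedBall s₀ (r / 2)) := isCompact_closedBall _ _
  have hKα : ∀ σ, IsCompact ((fun s : ℂ => α₀ σ + u * s) '' Metric.closedBall s₀ (r / 2)) := fun σ => hKc.image (by fun_prop)
  have hLβ : ∀ σ, IsCompact ((fun s : ℂ => β₀ σ + v * s) '' Metric.closedBall s₀ (r / 2)) := fun σ => hKc.image (by fun_prop)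
  have hL0 : ∀ σ, ∀ β ∈ (fun s : ℂ => β₀ σ + v * s) '' Metric.closedBall s₀ (r / 2), 0 < β.re := by
    rintro σ β ⟨s, hs, rfl⟩
    exact hU0 s (hKU hs) σ
  choose C N N' hC hN hN' hB using fun σ => norm_xiShift_le₂ (hg σ) (hKα σ) (hLβ σ) (hL0 σ)
  obtain ⟨A, M, hA, hcK⟩ := hcb _ hKU hKc
  set M' : ℝ := max M 0 with hM'
  set Nm : ℝ := ∑ σ, N σ with hNm
  set Nm' : ℝ := ∑ σ, N' σ with hNm'
  have hNm0 : 0 ≤ Nm := Finset.sum_nonneg fun σ _ => hN σ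
  have hNm'0 : 0 ≤ Nm' := Finset.sum_nonneg fun σ _ => hN' σ
  have hNle : ∀ σ, N σ ≤ Nm := fun σ => Finset.single_le_sum (f := N) (fun τ _ => hN τ) (Finset.mem_univ σ)
  have hN'le : ∀ σ, N' σ ≤ Nm' := fun σ => Finset.single_le_sum (f := N') (fun τ _ => hN' τ) (Finset.mem_univ σ)
  have hBK : Metric.ball s₀ (r / 2) ⊆ Metric.closedBall s₀ (r / 2) := Metric.ball_subset_closedBall
  -- holomorphy on the open ball by the M-test
  suffices hD : DifferentiableOn ℂ (fun s : ℂ => ∑' i, c i s * ∏ σ, xiShift (g σ) (h i σ) (α₀ σ + u * s) (β₀ σ + v * s))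
      (Metric.ball s₀ (r / 2)) from
    (hD.differentiableAt (Metric.isOpen_ball.mem_nhds (Metric.mem_ball_self hr2))).differentiableWithinAt
  refine differentiableOn_tsum_of_summable_norm
    (u := fun i => A * (∏ σ, 2 * C σ) * ∏ σ, (Real.exp (-(2 * Real.pi * ((h i σ * g σ).trace).re)) *
      (1 + ((h i σ 0 0).re + (h i σ 1 1).re)) ^ (M' + Nm) * (1 + ((h i σ 0 0).re * (h i σ 1 1).re - normSq (h i σ 0 1)) ^ (-Nm'))))
    ((hsum (M' + Nm) Nm' (by positivity) hNm'0).mul_left (A * ∏ σ, 2 * C σ)) (fun i => ?_) Metric.isOpen_ball (fun i s hs => ?_)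
  · -- each term is holomorphic on the ball
    refine ((hc i).mono (hBK.trans hKU)).mul ?_
    refine DifferentiableOn.fun_finsetProd fun σ _ => ?_
    exact differentiableOn_xiShift_affine (hg σ) (hh i σ) (α₀ σ) (β₀ σ) u v fun s hs => hU0 s (hKU (hBK hs)) σ
  · -- the M-test bound
    have h1 := hcK i s (hBK hs)
    have htr0 : ∀ σ, 0 < (h i σ 0 0).re + (h i σ 1 1).re := fun σ => trace_re_pos_of_posDef (hh i σ)
    have htr : ∀ σ, 0 < 1 + ((h i σ 0 0).re + (h i σ 1 1).re) := fun σ => by linarith [htr0 σ]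
    have hdet : ∀ σ, 0 < (h i σ 0 0).re * (h i σ 1 1).re - normSq (h i σ 0 1) := fun σ => by
      have hcσ := (posDef_hermTwo_iff ((h i σ 0 0).re, h i σ 0 1, (h i σ 1 1).re)).mp
        (by rw [hermTwo_eq_of_isHermitian (hh i σ).1]; exact hh i σ)
      simp only at hcσ
      linarith [hcσ.2]
    -- per place: `‖xiShift_σ‖ ≤ C_σ e_σ (1 + tr_σ)^{Nm} · 2 (1 + det_σ^{−Nm′})`
    have h2 : ∀ σ, ‖xiShift (g σ) (h i σ) (α₀ σ + u * s) (β₀ σ + v * s)‖ ≤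
        C σ * Real.exp (-(2 * Real.pi * ((h i σ * g σ).trace).re)) * (1 + ((h i σ 0 0).re + (h i σ 1 1).re)) ^ Nm *
          (2 * (1 + ((h i σ 0 0).re * (h i σ 1 1).re - normSq (h i σ 0 1)) ^ (-Nm'))) := by
      intro σ
      have hb := hB σ (h i σ) (hh i σ) (α₀ σ + u * s) ⟨s, hBK hs, rfl⟩ (β₀ σ + v * s) ⟨s, hBK hs, rfl⟩
      refine hb.trans ?_
      have e1 : (1 + ((h i σ 0 0).re + (h i σ 1 1).re)) ^ N σ ≤ (1 + ((h i σ 0 0).re + (h i σ 1 1).re)) ^ Nm :=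
        Real.rpow_le_rpow_of_exponent_le (by linarith [htr0 σ]) (hNle σ)
      have e2 : 1 + ((h i σ 0 0).re * (h i σ 1 1).re - normSq (h i σ 0 1)) ^ (-N' σ) ≤
          2 * (1 + ((h i σ 0 0).re * (h i σ 1 1).re - normSq (h i σ 0 1)) ^ (-Nm')) :=
        one_add_rpow_neg_le_two_mul (hdet σ) (hN' σ) (hN'le σ)
      have hCe : 0 ≤ C σ * Real.exp (-(2 * Real.pi * ((h i σ * g σ).trace).re)) := mul_nonneg (hC σ) (Real.exp_pos _).le
      exact mul_le_mul (mul_le_mul_of_nonneg_left e1 hCe) e2 (by linarith [Real.rpow_nonneg (hdet σ).le (-N' σ)])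
        (mul_nonneg hCe (Real.rpow_nonneg (htr σ).le _))
    -- the coefficient: `‖c i s‖ ≤ A ∏_σ (1 + tr_σ)^{M'}`
    have h1' : ‖c i s‖ ≤ A * ∏ σ, (1 + ((h i σ 0 0).re + (h i σ 1 1).re)) ^ M' := by
      refine h1.trans (mul_le_mul_of_nonneg_left ?_ hA)
      exact Finset.prod_le_prod (fun σ _ => Real.rpow_nonneg (htr σ).le _) fun σ _ =>
        Real.rpow_le_rpow_of_exponent_le (by linarith [htr0 σ]) (le_max_left _ _)
    rw [norm_mul, norm_prod]
    have hP0 : 0 ≤ ∏ σ, ‖xiShift (g σ) (h i σ) (α₀ σ + u * s) (β₀ σ + v * s)‖ := Finset.prod_nonneg fun σ _ => norm_nonneg _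
    calc ‖c i s‖ * ∏ σ, ‖xiShift (g σ) (h i σ) (α₀ σ + u * s) (β₀ σ + v * s)‖
        ≤ (A * ∏ σ, (1 + ((h i σ 0 0).re + (h i σ 1 1).re)) ^ M') *
            ∏ σ, (C σ * Real.exp (-(2 * Real.pi * ((h i σ * g σ).trace).re)) * (1 + ((h i σ 0 0).re + (h i σ 1 1).re)) ^ Nm *
              (2 * (1 + ((h i σ 0 0).re * (h i σ 1 1).re - normSq (h i σ 0 1)) ^ (-Nm')))) :=
          mul_le_mul h1' (Finset.prod_le_prod (fun σ _ => norm_nonneg _) fun σ _ => h2 σ) hP0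
            (mul_nonneg hA (Finset.prod_nonneg fun σ _ => Real.rpow_nonneg (htr σ).le _))
      _ = A * (∏ σ, 2 * C σ) * ∏ σ, (Real.exp (-(2 * Real.pi * ((h i σ * g σ).trace).re)) *
            (1 + ((h i σ 0 0).re + (h i σ 1 1).re)) ^ (M' + Nm) * (1 + ((h i σ 0 0).re * (h i σ 1 1).re - normSq (h i σ 0 1)) ^ (-Nm'))) := by
          rw [mul_assoc A, mul_assoc A, ← Finset.prod_mul_distrib, ← Finset.prod_mul_distrib]
          congr 1
          refine Finset.prod_congr rfl fun σ _ => ?_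
          rw [Real.rpow_add (htr σ)]
          ring

/-- THE DIAGONAL OF ROAD Φ (`u = v = 1`): `s ↦ Σ_i c_i(s) ∏_σ Ξ(g_σ, h_{iσ}; a_σ + s, b_σ + s)` is holomorphic on any open `U` with
`0 < re(b_σ + s)` on `U`, under the same coefficient growth and lattice summability hypotheses. -/
theorem differentiableOn_tsum_prod_xiShift_diag {ι S : Type*} [Fintype S] {g : S → Matrix (Fin 2) (Fin 2) ℂ} (hg : ∀ σ, (g σ).PosDef)
    (h : ι → S → Matrix (Fin 2) (Fin 2) ℂ) (hh : ∀ i σ, (h i σ).PosDef) (a b : S → ℂ) {U : Set ℂ} (hU : IsOpen U)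
    (hU0 : ∀ s ∈ U, ∀ σ, 0 < (b σ + s).re) (c : ι → ℂ → ℂ) (hc : ∀ i, DifferentiableOn ℂ (c i) U)
    (hcb : ∀ K ⊆ U, IsCompact K → ∃ A M : ℝ, 0 ≤ A ∧ ∀ i, ∀ s ∈ K, ‖c i s‖ ≤ A * ∏ σ, (1 + ((h i σ 0 0).re + (h i σ 1 1).re)) ^ M)
    (hsum : ∀ N N' : ℝ, 0 ≤ N → 0 ≤ N' → Summable fun i => ∏ σ, (Real.exp (-(2 * Real.pi * ((h i σ * g σ).trace).re)) *
      (1 + ((h i σ 0 0).re + (h i σ 1 1).re)) ^ N * (1 + ((h i σ 0 0).re * (h i σ 1 1).re - normSq (h i σ 0 1)) ^ (-N')))) :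
    DifferentiableOn ℂ (fun s : ℂ => ∑' i, c i s * ∏ σ, xiShift (g σ) (h i σ) (a σ + s) (b σ + s)) U := by
  have h1 := differentiableOn_tsum_prod_xiShift hg h hh a b 1 1 hU (fun s hs σ => by rw [one_mul]; exact hU0 s hs σ) c hc hcb hsum
  simp only [one_mul] at h1
  exact h1

end Summit.HodgeConjecture.HodgeConjecture.Cruxes.HLiu418.K2LiuHermTwoXiSeriesLattice

end
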